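/-
Copyright (c) 2026. All rights reserved.
Released under Apache 2.0 license as described in the file LICENSE.
Authors: abc-iut cell — seat abc-iut-f-104 (F fact-proving wave, tranche 104: FACT-LIST row F-0181
`MonoAnalyticizationExists` of `PanalocalTheaters.lean`), gen 3.
-/
import Literature.AnabelianGeometry.AbsoluteAnabelian.GaloisTheatersNumberFieldShadow
import Literature.AnabelianGeometry.AbsoluteAnabelian.NumberFieldValuationProSetDecomposition
import HarnessLib

/-!
# [AbsTopIII] Def 5.6 (ii)(b) at the number-field SHADOW: for every admissible `Π` and nonarchimedean `ṽ ∈ V⊚(Π)`, the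
# decomposition group `Π_ṽ` and its image `G_ṽ = aug(Π_ṽ)` are of MLF-Galois type

S. Mochizuki, *Topics in absolute anabelian geometry III* [MochizukiAbsTopIII2015], Def 5.6 (ii) p. 135 ("`G_w` … isomorphic
to the quotient `Π_v ↠ G_v` determined by the absolute Galois group of the base field", `G_w ∈ Ob(Orb(TG⊢))`), Def 5.1 (ii)
p. 114.

PROOF-ONLY companion (no `def` / `structure` / `instance`) of abc-iut-L4-d2's `GaloisTheatersNumberFieldShadow.lean` (the fields
of a `GlobalAnabelianContext` at the arithmetic shadow `E_F = (G_F →(id) G_F)`: `IsAdmissible F E := Nonempty (E ≅ extension F)`,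
`shadowProVal F E = V⊚(F̄/F)` pulled back along the admissibility isomorphism `shadowHom F E : Π_E ≅ G_F`).  For the eventual
shadow CONTEXT `R` (L4-d2, conditional on the Neukirch–Uchida fact; `R.proVal := shadowProVal F`), the hypothesis of the F-0181
instance form `monoAnalyticizationExists_of_isMLFGaloisType` (p429533) reads `∀ E admissible, ∀ ṽ ∈ V(Π_E)^non,
IsMLFGaloisType (R.galDecompGrp E ṽ)` with `R.galDecompGrp E ṽ = ProfiniteGrp.ofClosedSubgroup ⟨(Π_{E,ṽ}).map E.aug, _⟩`.
THIS FILE PROVES EXACTLY THAT SHAPE, unconditionally, from `NumberFieldValuationProSetDecomposition.lean`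
(`G_A ≃ₜ* Gal(F̄_v/F_v)` at `V⊚(F̄/F)`):

* `coe_shadowHom_of_isAdmissible` — at admissible `E`, `shadowHom` IS the (chosen) admissibility isomorphism `Π_E ≃ₜ* G_F`;
* `nonempty_continuousMulEquiv_decomp_shadowProVal` — `Π_{E,ṽ} ≃ₜ* G_A` (pull-back of a stabiliser along an isomorphism);
* **`isMLFGaloisType_decomp_shadowProVal`** — `Π_{E,ṽ} ∈ Ob(TG⊢)` for `ṽ ∈ V(Π_E)^non`;
* `aug_bijective_of_isAdmissible` — at the shadow `Δ = 1`, so `aug : Π_E → G_E` is a continuous bijection (it is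
  `isoGal⁻¹ ∘ isoArith` for the admissibility isomorphism), `nonempty_continuousMulEquiv_map_aug` — `H ≃ₜ* aug(H)` for closed `H`;
* **`isMLFGaloisType_galDecomp_shadowProVal`** — `G_ṽ = aug(Π_{E,ṽ}) ∈ Ob(TG⊢)`: the F-0181 hypothesis AT THE SHADOW, for every
  admissible `E` and nonarchimedean `ṽ`, with ANY closedness witness (proof-irrelevant).

HONEST LABEL: shadow ≠ print's `Π_X` (no curve, `Δ = 1`); the shadow CONTEXT term is not assembled here (L4-d2); classical
algebraic number theory assembled by name; nothing here bears on, and no side is taken on, [IUTchIII] Cor. 3.12; typed ≠ proved.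
-/

set_option autoImplicit false

noncomputable section

open scoped NumberField Pointwise
open CategoryTheory Topology Field

namespace Literature.AnabelianGeometry.AbsoluteAnabelian

namespace NumberFieldShadow

variable (F : Type) [Field F] [NumberField F]

/-! ### `shadowHom` at an admissible extension -/

/-- At an admissible `E`, the comparison homomorphism `shadowHom F E : Π_E → G_F` IS the chosen admissibility isomorphism
`isoArith (choice hE) : Π_E ≃ₜ* G_F` (unfolding the `dif`). [cite: MochizukiAbsTopIII2015, Def 5.1 (ii) p.114] -/
theorem coe_shadowHom_of_isAdmissible {E : FundamentalExtension.{0}} (hE : IsAdmissible F E) :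
    ⇑(shadowHom F E) = ⇑(AbsTopI.isoArith (Classical.choice hE)) := by
  rw [shadowHom, dif_pos hE]
  rfl

/-- Membership in a decomposition group of the shadow pro-set: `g ∈ Π_{E,ṽ} ↔ shadowHom g ∈ (G_F)_ṽ` (the pro-set is pulled
back along `shadowHom`). [cite: MochizukiAbsTopIII2015, Def 5.1 (iii) p.115] -/
theorem mem_decomp_shadowProVal_iff (E : FundamentalExtension.{0}) (v : (shadowProVal F E).carrier) (g : E.arith) :
    g ∈ (shadowProVal F E).decomp v ↔ shadowHom F E g ∈ (NumberField.valuationProSet F).decomp v := by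
  change g ∈ ((NumberField.valuationProSet F).comap (shadowHom F E)).decomp v ↔ _
  rw [GaloisProSet.decomp_comap, Subgroup.mem_comap]
  rfl

/-- **`Π_{E,ṽ} ≃ₜ* (G_F)_ṽ`** at an admissible `E`: the decomposition group of `ṽ` in the shadow pro-set `V⊚(Π_E)` is carried
isomorphically (as a topological group) onto the decomposition group of `ṽ` in `V⊚(F̄/F)` by the admissibility isomorphism.
[cite: MochizukiAbsTopIII2015, Def 5.1 (iii) p.115] -/
theorem nonempty_continuousMulEquiv_decomp_shadowProVal {E : FundamentalExtension.{0}} (hE : IsAdmissible F E)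
    (v : (shadowProVal F E).carrier) :
    Nonempty ((shadowProVal F E).decomp v ≃ₜ* (NumberField.valuationProSet F).decomp v) := by
  set ψ := AbsTopI.isoArith (Classical.choice hE) with hψ
  have hφ : ∀ g : E.arith, shadowHom F E g = ψ g := fun g => congrFun (coe_shadowHom_of_isAdmissible F hE) g
  have hmem : ∀ g : E.arith,
      g ∈ (shadowProVal F E).decomp v ↔ ψ g ∈ (NumberField.valuationProSet F).decomp v := fun g => by
    rw [mem_decomp_shadowProVal_iff, hφ]
    exact Iff.rfl
  refine ⟨{ toFun := fun x => ⟨ψ x.1, (hmem x.1).mp x.2⟩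
            invFun := fun y => ⟨ψ.symm y.1, (hmem _).mpr (by rw [ψ.apply_symm_apply]; exact y.2)⟩
            left_inv := fun x => Subtype.ext (ψ.symm_apply_apply x.1)
            right_inv := fun y => Subtype.ext (ψ.apply_symm_apply y.1)
            map_mul' := fun x y => Subtype.ext (map_mul ψ x.1 y.1)
            continuous_toFun := (ψ.continuous.comp continuous_subtype_val).subtype_mk _
            continuous_invFun := (ψ.symm.continuous.comp continuous_subtype_val).subtype_mk _ }⟩

/-- **`Π_{E,ṽ} ∈ Ob(TG⊢)` for nonarchimedean `ṽ`** at an admissible `E` of the shadow: the decomposition group of a nonarchimedean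
local element of `V⊚(Π_E)` is of MLF-Galois type (`≅ (G_F)_ṽ ≅ Gal(F̄_v/F_v)`, `isMLFGaloisType_decomp_inr_inl`).
[cite: MochizukiAbsTopIII2015, Def 5.6 (ii) p.135] -/
theorem isMLFGaloisType_decomp_shadowProVal {E : FundamentalExtension.{0}} (hE : IsAdmissible F E)
    (v : (shadowProVal F E).carrier) (hv : v ∈ (shadowProVal F E).non) :
    IsMLFGaloisType (ProfiniteGrp.ofClosedSubgroup (G := E.arith)
      ⟨(shadowProVal F E).decomp v, (shadowProVal F E).isClosed_decomp v⟩) := by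
  obtain ⟨A, rfl⟩ : v ∈ Set.range (fun A : NumberFieldValuationProSet.NonArch F =>
      (Sum.inr (Sum.inl A) : NumberFieldValuationProSet.Carrier F)) := hv
  obtain ⟨e⟩ := nonempty_continuousMulEquiv_decomp_shadowProVal F hE (Sum.inr (Sum.inl A))
  obtain ⟨k, _, _, hk, ⟨eH⟩⟩ := NumberFieldValuationProSet.isMLFGaloisType_decomp_inr_inl F A
  exact ⟨k, inferInstance, inferInstance, hk, ⟨e.trans eH⟩⟩

/-! ### The image under `aug` -/

/-- At an admissible `E` of the shadow (`Δ = 1`), `aug : Π_E → G_E` is `isoGal(e)⁻¹ ∘ isoArith(e)` for any admissibility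
isomorphism `e : E ≅ E_F` (the square of `e` with the augmentations; `aug_{E_F} = id`).
[cite: MochizukiAbsTopIII2015, Def 5.1 (ii) p.113] -/
theorem aug_eq_of_iso {E : FundamentalExtension.{0}} (e : E ≅ extension F) (x : E.arith) :
    E.aug x = (AbsTopI.isoGal e).symm (AbsTopI.isoArith e x) := by
  have h : e.hom.gal (E.aug x) = e.hom.arith x := (e.hom.comm x).symm
  rw [ContinuousMulEquiv.eq_symm_apply]
  exact h

/-- At an admissible `E` of the shadow, `aug : Π_E → G_E` is BIJECTIVE (`Δ_E = 1`).
[cite: MochizukiAbsTopIII2015, Def 5.1 (ii) p.113] -/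
theorem aug_bijective_of_isAdmissible {E : FundamentalExtension.{0}} (hE : IsAdmissible F E) :
    Function.Bijective E.aug := by
  obtain ⟨e⟩ := hE
  have h : ⇑E.aug = ⇑(AbsTopI.isoGal e).symm ∘ ⇑(AbsTopI.isoArith e) := funext (aug_eq_of_iso F e)
  rw [h]
  exact (AbsTopI.isoGal e).symm.bijective.comp (AbsTopI.isoArith e).bijective

/-- At an admissible `E` of the shadow, a CLOSED subgroup `H ⊆ Π_E` is carried isomorphically (as a topological group) onto its
image `aug(H) ⊆ G_E` (a continuous bijection from a compact group onto a Hausdorff one).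
[cite: MochizukiAbsTopIII2015, Def 5.6 (ii) p.135] -/
theorem nonempty_continuousMulEquiv_map_aug {E : FundamentalExtension.{0}} (hE : IsAdmissible F E)
    (H : Subgroup E.arith) (hH : IsClosed (H : Set E.arith)) :
    Nonempty (H ≃ₜ* H.map E.aug.toMonoidHom) := by
  haveI : CompactSpace H := isCompact_iff_compactSpace.mp hH.isCompact
  have hinj : Function.Injective E.aug := (aug_bijective_of_isAdmissible F hE).1
  let f : H →* H.map E.aug.toMonoidHom := (E.aug.toMonoidHom.subgroupMap H)
  have hf_inj : Function.Injective f := fun a b hab =>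
    Subtype.ext (hinj (congrArg Subtype.val hab))
  have hf_surj : Function.Surjective f := E.aug.toMonoidHom.subgroupMap_surjective H
  let e : H ≃* H.map E.aug.toMonoidHom := MulEquiv.ofBijective f ⟨hf_inj, hf_surj⟩
  have he_cont : Continuous e :=
    (E.aug.continuous.comp continuous_subtype_val).subtype_mk _
  have he_symm_cont : Continuous e.symm :=
    Continuous.continuous_symm_of_equiv_compact_to_t2 (f := e.toEquiv) he_cont
  exact ⟨{ e with continuous_toFun := he_cont, continuous_invFun := he_symm_cont }⟩

/-- **`G_ṽ = aug(Π_{E,ṽ}) ∈ Ob(TG⊢)` — the F-0181 hypothesis AT THE SHADOW.**  For every admissible `E` and every nonarchimedean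
`ṽ ∈ V⊚(Π_E)`, the image in `G_E` of the decomposition group is of MLF-Galois type (Def 5.6 (ii)(b): "`G_w` … the quotient
`Π_v ↠ G_v` determined by the absolute Galois group of the base field").  This is the shape `IsMLFGaloisType (R.galDecompGrp E ṽ)`
of `monoAnalyticizationExists_of_isMLFGaloisType` (p429533) for a context with `R.proVal = shadowProVal F` — the closedness
witness is arbitrary (proof-irrelevant). [cite: MochizukiAbsTopIII2015, Def 5.6 (ii) p.135] -/
theorem isMLFGaloisType_galDecomp_shadowProVal {E : FundamentalExtension.{0}} (hE : IsAdmissible F E)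
    (v : (shadowProVal F E).carrier) (hv : v ∈ (shadowProVal F E).non)
    (hclosed : IsClosed ((((shadowProVal F E).decomp v).map E.aug.toMonoidHom : Subgroup E.gal) : Set E.gal)) :
    IsMLFGaloisType (ProfiniteGrp.ofClosedSubgroup (G := E.gal)
      ⟨((shadowProVal F E).decomp v).map E.aug.toMonoidHom, hclosed⟩) := by
  obtain ⟨e⟩ := nonempty_continuousMulEquiv_map_aug F hE ((shadowProVal F E).decomp v)
    ((shadowProVal F E).isClosed_decomp v)
  obtain ⟨k, _, _, hk, ⟨eH⟩⟩ := isMLFGaloisType_decomp_shadowProVal F hE v hv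
  exact ⟨k, inferInstance, inferInstance, hk, ⟨e.symm.trans eH⟩⟩

end NumberFieldShadow

end Literature.AnabelianGeometry.AbsoluteAnabelian

end
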